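import Mathlib

/-!
# Pole laws of the level census (ENGINE B, pub-hlocus abs-2 g50) — helper anchor

certified instances and evidence bearing on the general Hodge conjecture; no claim.

Kernel-checked pieces of DERIVATIONS_engineB §68.4 (POLE LAWS).  In ENGINE B's doubled coordinates an optimal
embedding of `O_D` (D = -3d, d ≡ 1 mod 3, the ζ₃ universe) into the maximal order of `B_{3,∞}` is an integer
triple `U = (X, Y, W)` on the sphere `X² + 3Y² + 3W² = 4|D| = 12d` with `3 ∣ X`; the θ-level of a difference
`(dX, dY, dW)` is `min (2 v₃ dX) (2 v₃ dY + 1) (2 v₃ dW + 1)` and the six unit maps act by `m0 … m5` below.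
The two CM base points are poles of this sphere: the REAL pole `(0, ±2, 0)` (D = -3, j = 0) and the IMAGINARY
pole `(0, 0, 4)` with its unit orbit (D = -12, j = 54000; 3-adic normaliser `s₋₁₂ = -2`).  We check:
`s12_eq` (the normaliser of -12 is exactly -2), the pole orbit level tables `{∞,∞,∞,1,1,1}` / `{∞,2,2,1,1,1}`
(`real_pole_fixed`, `real_pole_antipode`, `imag_pole_orbit`, `imag_pole_levels`), the sign split behind the
REAL half of the pole laws (`pole_split`, `sign_exclusive`: on the sphere, `3^k ∣ X² + 3W²` forces
`3^(k-1) ∣ Y - 2s` or `3^(k-1) ∣ Y + 2s` for exactly one sign, `s² ≡ d`), and the isomorphism-count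
bookkeeping `iso_count_imag` / `iso_count_real` (`6 + 3 + (H-2) = H + 7`, `3ω + 3`).  Certified data: pole laws
on 3 580 / 3 580 classes (|D| ≤ 4800), Gross–Zagier-shape totals = exact `v₃ disc H_D` for all 74 D ≤ 1000.
-/

set_option linter.dupNamespace false

namespace Summit.HodgeConjecture.HodgeConjecture.HodgeLocus.Census.PoleLawB

/-- Bounded 3-adic valuation on `ℤ` (fuel `f`; the value `40` stands for `∞` at `0`, as in the census code). -/
def v3b : ℕ → ℤ → ℕ
  | 0, _ => 0
  | f + 1, n => if n = 0 then 40 else if (3 : ℤ) ∣ n then v3b f (n / 3) + 1 else 0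

/-- θ-level of a difference vector `(dX, dY, dW)`: `min (2 v₃ dX) (2 v₃ dY + 1) (2 v₃ dW + 1)`. -/
def lev (d : ℤ × ℤ × ℤ) : ℕ :=
  min (2 * v3b 40 d.1) (min (2 * v3b 40 d.2.1 + 1) (2 * v3b 40 d.2.2 + 1))

/-- Coordinatewise difference. -/
def sub (u v : ℤ × ℤ × ℤ) : ℤ × ℤ × ℤ := (u.1 - v.1, u.2.1 - v.2.1, u.2.2 - v.2.2)

/-- The six unit maps of the census (identity, conj ρ, conj ρ², conj i, conj iρ, conj iρ²). -/
def m0 (u : ℤ × ℤ × ℤ) : ℤ × ℤ × ℤ := u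
/-- conj ρ -/
def m1 (u : ℤ × ℤ × ℤ) : ℤ × ℤ × ℤ := (-(u.1 + 3 * u.2.2) / 2, u.2.1, (u.1 - u.2.2) / 2)
/-- conj ρ² -/
def m2 (u : ℤ × ℤ × ℤ) : ℤ × ℤ × ℤ := ((-u.1 + 3 * u.2.2) / 2, u.2.1, -(u.1 + u.2.2) / 2)
/-- conj i -/
def m3 (u : ℤ × ℤ × ℤ) : ℤ × ℤ × ℤ := (u.1, -u.2.1, -u.2.2)
/-- conj iρ -/
def m4 (u : ℤ × ℤ × ℤ) : ℤ × ℤ × ℤ := (-(u.1 + 3 * u.2.2) / 2, -u.2.1, -(u.1 - u.2.2) / 2)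
/-- conj iρ² -/
def m5 (u : ℤ × ℤ × ℤ) : ℤ × ℤ × ℤ := ((-u.1 + 3 * u.2.2) / 2, -u.2.1, (u.1 + u.2.2) / 2)

/-- The REAL pole `U₀ = (0, 2, 0)` (the optimal embeddings of `O₋₃`). -/
def U0 : ℤ × ℤ × ℤ := (0, 2, 0)
/-- The IMAGINARY pole `U₁₂ = (0, 0, 4)` (an optimal embedding of `O₋₁₂ = ℤ[√-3]`, doubled coordinates). -/
def U12 : ℤ × ℤ × ℤ := (0, 0, 4)

/-- The 3-adic normaliser of `D = -12` is the integer `-2`: the square root of `4` that is `≡ 1 (mod 3)`. -/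
theorem s12_eq (s : ℤ) (hs : s ^ 2 = 4) (h1 : s % 3 = 1) : s = -2 := by
  have h : (s - 2) * (s + 2) = 0 := by nlinarith
  rcases mul_eq_zero.mp h with h2 | h2
  · omega
  · omega

/-- The REAL pole is fixed by `m0, m1, m2` … -/
theorem real_pole_fixed : m0 U0 = U0 ∧ m1 U0 = U0 ∧ m2 U0 = U0 := by decide

/-- … and sent to its antipode `(0, -2, 0)` by `m3, m4, m5`, at θ-level `1` from `U₀`:
the orbit of the REAL pole seen from `U₀` has levels `{∞, ∞, ∞, 1, 1, 1}`. -/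
theorem real_pole_antipode :
    m3 U0 = (0, -2, 0) ∧ m4 U0 = (0, -2, 0) ∧ m5 U0 = (0, -2, 0) ∧ lev (sub U0 (0, -2, 0)) = 1 := by decide

/-- The unit orbit of the IMAGINARY pole: `(0,0,4), (-6,0,-2), (6,0,-2), (0,0,-4), (-6,0,2), (6,0,2)`. -/
theorem imag_pole_orbit :
    m1 U12 = (-6, 0, -2) ∧ m2 U12 = (6, 0, -2) ∧ m3 U12 = (0, 0, -4) ∧
    m4 U12 = (-6, 0, 2) ∧ m5 U12 = (6, 0, 2) := by decide

/-- Seen from `U₁₂`, the other five vectors of its orbit sit at θ-levels `2, 2, 1, 1, 1` — so a class at orbit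
level `L ≥ 3` from the IMAGINARY pole has level pattern `{L, 2, 2, 1, 1, 1}` and pattern sum `L + 7`. -/
theorem imag_pole_levels :
    [lev (sub (m1 U12) U12), lev (sub (m2 U12) U12), lev (sub (m3 U12) U12),
     lev (sub (m4 U12) U12), lev (sub (m5 U12) U12)] = [2, 2, 1, 1, 1] := by decide

/-- Worked instance of the IMAGINARY pole law (D = -39; the IMAGINARY class with `H_σ = 3`, `β = v₃(Y) = 1`):
the embedding `U = (6, 6, 2)` (`6² + 3·6² + 3·2² = 156 = 4·39`) against the pole vector `(6, 0, 2)` of the orbit of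
`U₁₂`, with the normalisers `s₋₁₂ = -2` and `s₋₃₉ ≡ 259 (mod 3⁶)` (`259² ≡ 13 (mod 3⁶)`, `259 ≡ 1 (mod 3)`):
the difference `U·s₋₁₂ - (6,0,2)·s₋₃₉` has θ-level exactly `3 = H_σ` (valuations `3, 1, 2` in the three slots;
the truncation of `s₋₃₉` modulo `3⁶` does not affect valuations below `6`). -/
theorem worked_39 :
    (6 : ℤ) ^ 2 + 3 * 6 ^ 2 + 3 * 2 ^ 2 = 4 * 39 ∧ (259 : ℤ) ^ 2 % 729 = 13 ∧ (259 : ℤ) % 3 = 1 ∧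
    lev (sub ((-2) * 6, (-2) * 6, (-2) * 2) (259 * 6, 259 * 0, 259 * 2)) = 3 := by decide

/-- SIGN SPLIT (the REAL half of the pole laws, and the identity image of the IMAGINARY half by `Y ↔ W`):
on the sphere `X² + 3Y² + 3W² = 12d`, if `3^k ∣ X² + 3W²` and `s² ≡ d (mod 3^k)` (so `3^k ∣ 12(d - s²)`),
then `3^(k-1)` divides `Y - 2s` or `Y + 2s`.  (With `k = v₃(X² + 3W²) = ω` this is the middle slot `2ω - 1 ≥ ω`
of the level against the pole `(0, 2s, 0)` of the right sign.) -/
theorem pole_split (X Y W s d : ℤ) (k : ℕ) (hk1 : 1 ≤ k) (hS : X ^ 2 + 3 * Y ^ 2 + 3 * W ^ 2 = 12 * d)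
    (hk : (3 : ℤ) ^ k ∣ X ^ 2 + 3 * W ^ 2) (hsd : (3 : ℤ) ^ k ∣ 12 * (d - s ^ 2)) (hs : ¬ (3 : ℤ) ∣ s) :
    (3 : ℤ) ^ (k - 1) ∣ Y - 2 * s ∨ (3 : ℤ) ^ (k - 1) ∣ Y + 2 * s := by
  -- 3 (Y - 2s)(Y + 2s) = 12 (d - s²) - (X² + 3 W²)
  have key : 3 * ((Y - 2 * s) * (Y + 2 * s)) = 12 * (d - s ^ 2) - (X ^ 2 + 3 * W ^ 2) := by nlinarith
  have h3 : (3 : ℤ) ^ k ∣ 3 * ((Y - 2 * s) * (Y + 2 * s)) := by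
    rw [key]; exact dvd_sub hsd hk
  have hpow : (3 : ℤ) ^ k = 3 * 3 ^ (k - 1) := by
    obtain ⟨j, rfl⟩ : ∃ j, k = j + 1 := ⟨k - 1, by omega⟩
    simp [pow_succ, mul_comm]
  rw [hpow] at h3
  have h4 : (3 : ℤ) ^ (k - 1) ∣ (Y - 2 * s) * (Y + 2 * s) :=
    (mul_dvd_mul_iff_left (by norm_num : (3 : ℤ) ≠ 0)).mp h3
  have hp : Prime (3 : ℤ) := Int.prime_three
  by_cases hY : (3 : ℤ) ∣ Y + 2 * s
  · -- then 3 ∤ Y - 2s, so 3^(k-1) is coprime to (Y - 2s) and divides (Y + 2s)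
    right
    have hn : ¬ (3 : ℤ) ∣ Y - 2 * s := by
      intro h
      have : (3 : ℤ) ∣ (Y + 2 * s) - (Y - 2 * s) := dvd_sub hY h
      have h4s : (3 : ℤ) ∣ 4 * s := by
        have e : (Y + 2 * s) - (Y - 2 * s) = 4 * s := by ring
        rwa [e] at this
      rcases hp.dvd_or_dvd h4s with h4 | h4'
      · norm_num at h4
      · exact hs h4'
    have hcop : IsCoprime ((3 : ℤ) ^ (k - 1)) (Y - 2 * s) :=
      IsCoprime.pow_left ((Int.isCoprime_iff_gcd_eq_one).mpr (by
        have := Int.gcd_dvd_left 3 (Y - 2 * s)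
        have h3' := Int.gcd_dvd_right 3 (Y - 2 * s)
        have hle : Int.gcd 3 (Y - 2 * s) ∣ 3 := by exact_mod_cast this
        rcases (Nat.dvd_prime Nat.prime_three).mp hle with h | h
        · exact h
        · exfalso; apply hn; rw [h] at h3'; exact_mod_cast h3'))
    exact hcop.dvd_of_dvd_mul_left h4
  · left
    have hcop : IsCoprime ((3 : ℤ) ^ (k - 1)) (Y + 2 * s) :=
      IsCoprime.pow_left ((Int.isCoprime_iff_gcd_eq_one).mpr (by
        have := Int.gcd_dvd_left 3 (Y + 2 * s)
        have h3' := Int.gcd_dvd_right 3 (Y + 2 * s)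
        have hle : Int.gcd 3 (Y + 2 * s) ∣ 3 := by exact_mod_cast this
        rcases (Nat.dvd_prime Nat.prime_three).mp hle with h | h
        · exact h
        · exfalso; apply hY; rw [h] at h3'; exact_mod_cast h3'))
    exact hcop.dvd_of_dvd_mul_right h4

/-- The two signs exclude each other: `3` cannot divide both `Y - 2s` and `Y + 2s` when `3 ∤ s`
(their difference is `4s`).  So against the pole of the wrong sign the middle slot has valuation `0`, level `1`. -/
theorem sign_exclusive (Y s : ℤ) (hs : ¬ (3 : ℤ) ∣ s) :
    ¬ ((3 : ℤ) ∣ Y - 2 * s ∧ (3 : ℤ) ∣ Y + 2 * s) := by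
  rintro ⟨h1, h2⟩
  have h : (3 : ℤ) ∣ (Y + 2 * s) - (Y - 2 * s) := dvd_sub h2 h1
  have e : (Y + 2 * s) - (Y - 2 * s) = 4 * s := by ring
  rw [e] at h
  rcases Int.prime_three.dvd_or_dvd h with h4 | h4
  · norm_num at h4
  · exact hs h4

/-- Isomorphism-count bookkeeping, IMAGINARY class against the IMAGINARY pole: with level pattern
`{H, 2, 2, 1, 1, 1}` (`H ≥ 2`) the numbers of unit images at level `≥ n` are `6, 3, 1, …, 1` (`n = 1, …, H`),
summing to `6 + 3 + (H - 2) = H + 7 = v_θ(j(𝔞) - 54000)` (the E-54K depth law). -/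
theorem iso_count_imag (H : ℕ) (hH : 2 ≤ H) : 6 + 3 + (H - 2) = H + 7 ∧ H + 2 + 2 + 1 + 1 + 1 = H + 7 := by
  omega

/-- Same bookkeeping, REAL class against the REAL pole: pattern `{ω, ω, ω, 1, 1, 1}`, counts `6, 3, 3, …, 3`
(`n = 1, …, ω`), sum `6 + 3(ω - 1) = 3ω + 3 = v_θ(j(𝔞))` (A's slope law `3w + 3`). -/
theorem iso_count_real (ω : ℕ) (hω : 1 ≤ ω) : 6 + 3 * (ω - 1) = 3 * ω + 3 ∧ ω + ω + ω + 1 + 1 + 1 = 3 * ω + 3 := by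
  omega

end Summit.HodgeConjecture.HodgeConjecture.HodgeLocus.Census.PoleLawB
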